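/-
Copyright (c) 2026 the pub-hodgecm-mathlib formalisation cell (harness21).  Prover seat hodgecm-mathlib-LH7-p02 (g6): LH4-plan (g7) (C3d) census
`F0/P3c/LH7/LH7-p02/g6/c3d/CENSUS-C3d-JZeroNearTrace.v1.LH7p02g6.md` §0.3 — the DOCKABLE form of the frame-currency pair counts ★ p851939∕p851954 (this hand):
the shift `e` any `σ`-fixed UNIT, the target decoupled; 2026-09-02.
-/
import Literature.NumberTheory.LocalFields.UnramifiedQuadraticNormResidueShiftHighPairsTrace   -- ★ p851939∕p851954 (this hand): §1 frame splitting (`fixed_add_mul_frame_inj`, `exists_fixed_add_mul_frame_eq`), the tied counts; brings ★ FILES 7–10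
import HarnessLib

/-!
# The frame-currency pair counts of Flicker's Prop. 13 (c)∕(e) for ANY σ-fixed unit shift `e` (target decoupled) — FILE 8″∕10″ of the story `UnramifiedQuadraticNorm*`
(Flicker (1998), *Elementary proof of the fundamental lemma for a unitary group*, Prop. 13 p. 93; Serre, *Local Fields*, V §2)

Topic `NumberTheory/LocalFields`, namespace `Literature.NumberTheory.LocalFields.UnramifiedQuadraticNorm`.  THEOREMS ONLY: no definition, no named fact, no instance, no
notation, no `sorry`; kernel lane `--supports stmt-HodgeConjecture-24833`.  Cell `pub/hodgecm-mathlib` (D-0151), crux H413; LH4-plan (g7) LAYER C, brick (C3d)'s supplier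
(census `CENSUS-C3d-JZeroNearTrace.v1` §0.3).  HC_CM is proved only modulo the 7 printed citations (2 remaining named inputs: hLiu418 = stmt-HodgeConjecture-24832,
h413 = stmt-HodgeConjecture-24833) until rung 0 closes; count-neutral ((D-UNR) stays PRINT by D74′); proves no letter.

WHY.  ★ p851939 ties the shift to the target (`e² − 1 = ϖ^{2ℓ}γ`) because its unit claim argues from `e² − 1 ∈ 𝔪`; the (C3d)∕(C3e) coset counts of the TRACE normal form
(★ p851968: `X = κ·(ν⁻¹ + c₁ + y·g′)`) dock with a shift `c₁` whose residue need not be `±1`.  For a target in `𝔪` (`1 ≤ ℓ`) the range step only needs **`e ∈ Rˣ`**: if `e² − 1`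
is a unit then `N z ∈ 𝔪 ⇒ z ∈ 𝔪 ⇒ F ∈ 𝔪` (frame coordinates) and `F − e ≡ −e` is a unit; if `e² − 1 ∈ 𝔪` the ★ argument applies to `N z − (e² − 1) = (N z − c) + (c − (e² − 1)) ∈ 𝔪`.

* §1 `mem_maximalIdeal_of_frame` (`F + y·g ∈ 𝔪`, `F, y` `τ`-fixed ⇒ `F, y ∈ 𝔪`), **`isUnit_fixed_sub_of_norm_sub_frame_of_isUnit`** (`e` a unit, target `c ∉ Aˣ`, `N z − c ∉ Aˣ` ⇒
  `F − e ∈ Aˣ`).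
* §2 **`natCard_pairs_norm_congr_shift_frame_of_isUnit`** (`2ℓ < j ≤ m`) and **`…_of_isUnit_exists`** (`2ℓ < j ≤ m + ℓ`): binders = ★ p851939∕p851954's with
  `(hec : e² − 1 = ϖ^{2ℓ}γ) ↦ (he : IsUnit e)`; RHS VERBATIM (print's).  ★ p851939∕p851954 are the case `e² ≡ 1` and are NOT restated.

## References
* [Flicker1998UnitaryFL] Y. Z. Flicker, *Elementary proof of the fundamental lemma for a unitary group*, Canad. J. Math. 50 (1998), 74–98: Prop. 13 p. 93 (cases (c)∕(e)).
* [Serre1979] J.-P. Serre, *Local Fields*, GTM 67 (1979), Ch. V §2 Prop. 2–3.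
-/

set_option autoImplicit false
namespace Literature.NumberTheory.LocalFields.UnramifiedQuadraticNorm

open Literature.LinearAlgebra.Matrix.HermitianFormsHensel Literature.NumberTheory.GaloisRepresentations IsLocalRing

universe u
variable {R : Type u} [CommRing R] (σ : R →+* R)

/-! ## §1 The unit claim for a unit shift and a non-unit target -/

section Local

variable {A : Type u} [CommRing A] (τ : A →+* A) (hτ : ∀ a, τ (τ a) = a) {g : A} (hg : IsUnit (τ g - g))

include hτ hg in
/-- **Frame coordinates of a non-unit are non-units**: in a local ring with involution `τ` and frame unit `τg − g`, if `F + y·g ∈ 𝔪` with `τF = F`, `τy = y` then `y ∈ 𝔪` and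
`F ∈ 𝔪` (`τ(F + yg) − (F + yg) = y(τg − g)`). [cite: Serre1979, Ch. V §2] -/
theorem mem_maximalIdeal_of_frame [IsLocalRing A] {F y : A} (hF : τ F = F) (hy : τ y = y) (hz : F + y * g ∈ maximalIdeal A) :
    F ∈ maximalIdeal A ∧ y ∈ maximalIdeal A := by
  have hτnu : ∀ w : A, ¬ IsUnit w → ¬ IsUnit (τ w) := fun w hw hu => hw (by have h := hu.map τ; rwa [hτ] at h)
  have hτz : τ (F + y * g) ∈ maximalIdeal A := (mem_maximalIdeal _).2 (hτnu _ ((mem_maximalIdeal _).1 hz))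
  have hdiff : y * (τ g - g) ∈ maximalIdeal A := by
    have h : y * (τ g - g) = τ (F + y * g) - (F + y * g) := by rw [map_add, map_mul, hF, hy]; ring
    rw [h]; exact Ideal.sub_mem _ hτz hz
  have hy' : y ∈ maximalIdeal A := by
    obtain ⟨d, hd⟩ := hg
    have : y = y * (τ g - g) * ↑d⁻¹ := by rw [← hd, mul_assoc, Units.mul_inv, mul_one]
    rw [this]; exact Ideal.mul_mem_right _ _ hdiff
  refine ⟨?_, hy'⟩
  have : F = (F + y * g) - y * g := by ring
  rw [this]; exact Ideal.sub_mem _ hz (Ideal.mul_mem_right _ _ hy')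

include hτ hg in
/-- **The fixed coordinate minus a UNIT `e` is a unit** when the target `c` is a non-unit and `N(z) − c` is a non-unit, `z = F + y·g` in the frame splitting (local ring, involution `τ`,
frame unit `τg − g`; EVERY characteristic; NO tie between `e` and `c`): if `e² − 1 ∈ 𝔪` this is ★ `isUnit_fixed_sub_of_norm_sub_frame` applied to `N z − (e² − 1) = (N z − c) + (c − (e² − 1)) ∈ 𝔪`;
if `e² − 1` is a unit then `N z = (N z − c) + c ∈ 𝔪`, so `z ∈ 𝔪`, so `F ∈ 𝔪` (`mem_maximalIdeal_of_frame`) and `F − e ≡ −e` is a unit. [cite: Flicker1998UnitaryFL, Prop. 13 p. 93] -/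
theorem isUnit_fixed_sub_of_norm_sub_frame_of_isUnit [IsLocalRing A] {e c F y : A} (hτe : τ e = e) (he : IsUnit e) (hc : ¬ IsUnit c)
    (hF : τ F = F) (hy : τ y = y) (hN : ¬ IsUnit ((F + y * g) * τ (F + y * g) - c)) : IsUnit (F - e) := by
  by_cases he1 : IsUnit (e ^ 2 - 1)
  · -- `N z ∈ 𝔪`, hence `z ∈ 𝔪`, hence `F ∈ 𝔪`
    have hNz : (F + y * g) * τ (F + y * g) ∈ maximalIdeal A := by
      have : (F + y * g) * τ (F + y * g) = ((F + y * g) * τ (F + y * g) - c) + c := by ring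
      rw [this]; exact Ideal.add_mem _ ((mem_maximalIdeal _).2 hN) ((mem_maximalIdeal _).2 hc)
    have hz : F + y * g ∈ maximalIdeal A := by
      rcases Ideal.IsPrime.mem_or_mem (IsLocalRing.maximalIdeal.isMaximal A).isPrime hNz with h | h
      · exact h
      · exact (mem_maximalIdeal _).2 fun hu => ((mem_maximalIdeal _).1 h) (hu.map τ)
    have hFm : F ∈ maximalIdeal A := (mem_maximalIdeal_of_frame τ hτ hg hF hy hz).1
    -- `F − e = −(e − F)` with `e` a unit and `F ∈ 𝔪`
    by_contra hFe
    have : e ∈ maximalIdeal A := by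
      have h : e = F - (F - e) := by ring
      rw [h]; exact Ideal.sub_mem _ hFm ((mem_maximalIdeal _).2 hFe)
    exact (mem_maximalIdeal _).1 this he
  · -- `e² − 1 ∈ 𝔪`: the ★ argument with `c` in place of `e² − 1`
    refine isUnit_fixed_sub_of_norm_sub_frame τ hτ hg hτe he1 hF hy ?_
    intro hu
    have hsum : (F + y * g) * τ (F + y * g) - (e ^ 2 - 1) = ((F + y * g) * τ (F + y * g) - c) + (c - (e ^ 2 - 1)) := by ring
    have hmem : (F + y * g) * τ (F + y * g) - (e ^ 2 - 1) ∈ maximalIdeal A := by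
      rw [hsum]
      exact Ideal.add_mem _ ((mem_maximalIdeal _).2 hN) (Ideal.sub_mem _ ((mem_maximalIdeal _).2 hc) ((mem_maximalIdeal _).2 he1))
    exact (mem_maximalIdeal _).1 hmem hu

end Local

/-! ## §2 The pair counts for a unit shift `e` and a decoupled target `ϖ^{2ℓ}γ` (no `2 ∈ Rˣ`) -/

section Count

variable [IsDomain R] [IsDiscreteValuationRing R] [Finite (ResidueField R)] [IsAdicComplete (maximalIdeal R) R]
  (hσ : ∀ a, σ (σ a) = a) {a : R} (ha : IsUnit (σ a - a)) {q : ℕ} (hq : Nat.card (ResidueField R) = q ^ 2) {g : R} (hg : IsUnit (σ g - g))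

include ha hq hg in
/-- **THE PAIR COUNT OF PROP. 13, CASES (c)∕(e), IN THE FRAME CURRENCY, FOR ANY `σ`-FIXED UNIT SHIFT `e` — EVERY RESIDUE CHARACTERISTIC** (`ρ_m`-currency): for `1 ≤ ℓ`,
`2ℓ < j ≤ m`, a `σ`-fixed UNIT `e`, a target `ϖ^{2ℓ}γ` (`γ ∈ (R^σ)^×`, `ϖ` a `σ`-fixed uniformiser; NO tie `e² − 1 = ϖ^{2ℓ}γ`) and a frame element `g` (`σg − g ∈ Rˣ`),
`#{(u, y) ∈ (R ⧸ 𝔪^m)² : u ∈ (R⧸𝔪^m)^×, σ̄y = y, N((uσ̄u)⁻¹ + ē + y·ḡ) ≡ ϖ^{2ℓ}γ (mod 𝔪^j)} = q^{m−1}(q+1) · (q^{(m−ℓ)−(j−2ℓ)} · q^{m−ℓ−1}(q+1))` — the ★ FILE 8 value VERBATIM: the map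
`(u,y) ↦ z = (uσ̄u)⁻¹ + ē + y·ḡ` has norm-fibre fibres (§1 uniqueness of the frame splitting) over exactly the classes counted by ★ `natCard_norm_congr_shift` (§1 existence of the
splitting + the unit claim `isUnit_fixed_sub_of_norm_sub_frame_of_isUnit`, which needs only `e ∈ Rˣ` and a target in `𝔪`, i.e. `1 ≤ ℓ`).  ★ p851939 `natCard_pairs_norm_congr_shift_frame`
(tie `e² − 1 = ϖ^{2ℓ}γ`) is the special case `e² ≡ 1`; this is the form the (C3d)∕(C3e) coset counts dock on (census `CENSUS-C3d-JZeroNearTrace.v1` §0.3). [cite: Flicker1998UnitaryFL, Prop. 13 p. 93]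
[cite: Serre1979, Ch. V §2 Prop. 3] -/
theorem natCard_pairs_norm_congr_shift_frame_of_isUnit {p : R} (hp : Irreducible p) (hσp : σ p = p) {m j ℓ : ℕ} (hm : 1 ≤ m) (hℓ : 1 ≤ ℓ) (hj : 2 * ℓ < j) (hjm : j ≤ m)
    {e γ : R} (he : IsUnit e) (hσe : σ e = e) (hγ : IsUnit γ) (hσγ : σ γ = γ) :
    Nat.card {uy : (R ⧸ maximalIdeal R ^ m) × (R ⧸ maximalIdeal R ^ m) // IsUnit uy.1 ∧
      Ideal.quotientMap (maximalIdeal R ^ m) σ (maximalIdeal_pow_le_comap σ hσ m) uy.2 = uy.2 ∧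
      Ideal.Quotient.factor (Ideal.pow_le_pow_right hjm)
        ((Ring.inverse (uy.1 * Ideal.quotientMap (maximalIdeal R ^ m) σ (maximalIdeal_pow_le_comap σ hσ m) uy.1) +
            Ideal.Quotient.mk (maximalIdeal R ^ m) e + uy.2 * Ideal.Quotient.mk (maximalIdeal R ^ m) g) *
          Ideal.quotientMap (maximalIdeal R ^ m) σ (maximalIdeal_pow_le_comap σ hσ m)
            (Ring.inverse (uy.1 * Ideal.quotientMap (maximalIdeal R ^ m) σ (maximalIdeal_pow_le_comap σ hσ m) uy.1) +
              Ideal.Quotient.mk (maximalIdeal R ^ m) e + uy.2 * Ideal.Quotient.mk (maximalIdeal R ^ m) g)) =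
        Ideal.Quotient.mk (maximalIdeal R ^ j) (p ^ (2 * ℓ) * γ)} =
      (q ^ (m - 1) * (q + 1)) * (q ^ ((m - ℓ) - (j - 2 * ℓ)) * (q ^ ((m - ℓ) - 1) * (q + 1))) := by
  classical
  haveI := CompleteLocalRing.finite_quotient_maximalIdeal_pow (R := R) m
  set A := R ⧸ maximalIdeal R ^ m with hA
  set τ := Ideal.quotientMap (maximalIdeal R ^ m) σ (maximalIdeal_pow_le_comap σ hσ m) with hτ
  set φ := Ideal.Quotient.factor (S := maximalIdeal R ^ m) (T := maximalIdeal R ^ j) (Ideal.pow_le_pow_right hjm) with hφ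
  have hττ : ∀ z, τ (τ z) = z := quotientMap_quotientMap σ hσ m
  have hτmk : ∀ w : R, τ (Ideal.Quotient.mk _ w) = Ideal.Quotient.mk _ (σ w) := fun w => Ideal.quotientMap_mk
  haveI : Nontrivial A := nontrivial_quotient_pow (R := R) hm
  haveI : IsLocalRing A := IsLocalRing.of_surjective' (Ideal.Quotient.mk (maximalIdeal R ^ m)) Ideal.Quotient.mk_surjective
  set gA : A := Ideal.Quotient.mk _ g with hgA
  have hgAu : IsUnit (τ gA - gA) := by
    have h := hg.map (Ideal.Quotient.mk (maximalIdeal R ^ m))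
    rwa [map_sub, ← hτmk] at h
  have hτinv : ∀ w : Aˣ, τ (w : A) = w → τ (↑w⁻¹ : A) = ↑w⁻¹ := fun w hw => by
    have h1 : τ (↑w⁻¹ : A) * (w : A) = 1 := by rw [← hw, ← map_mul, Units.inv_mul, map_one]
    calc τ (↑w⁻¹ : A) = τ ↑w⁻¹ * ((w : A) * ↑w⁻¹) := by rw [Units.mul_inv, mul_one]
      _ = ↑w⁻¹ := by rw [← mul_assoc, h1, one_mul]
  have hq0 : 0 < q := by
    rcases Nat.eq_zero_or_pos q with h0 | h0
    · exfalso
      have h1 : 0 < Nat.card (ResidueField R) := Nat.card_pos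
      rw [hq, h0] at h1; simp at h1
    · exact h0
  set eA : A := Ideal.Quotient.mk _ e with heA
  have hτe : τ eA = eA := by rw [heA, hτmk, hσe]
  -- the target class `c̄ = ϖ^{2ℓ}γ̄` is a non-unit (`1 ≤ ℓ`); `ē` is a unit
  set cA : A := Ideal.Quotient.mk _ (p ^ (2 * ℓ) * γ) with hcA
  have hcnu : ¬ IsUnit cA := by
    intro hu
    have hu' : IsUnit (p ^ (2 * ℓ) * γ) := isUnit_of_isUnit_mk_pow (R := R) hm hu
    have hpu : IsUnit (p ^ (2 * ℓ)) := isUnit_of_mul_isUnit_left hu'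
    exact hp.not_isUnit ((isUnit_pow_iff (by omega)).1 hpu)
  have hτc : τ cA = cA := by rw [hcA, hτmk, map_mul, map_pow, hσp, hσγ]
  have heAu : IsUnit eA := he.map _
  let Nm : A → A := fun u => u * τ u
  have hNfix : ∀ u, τ (Nm u) = Nm u := fun u => by simp only [Nm, map_mul, hττ, mul_comm]
  let α := {uy : A × A // IsUnit uy.1 ∧ τ uy.2 = uy.2}
  let Z : α → A := fun w => Ring.inverse (Nm w.1.1) + eA + w.1.2 * gA
  let G : A → Prop := fun z => φ (z * τ z) = Ideal.Quotient.mk (maximalIdeal R ^ j) (p ^ (2 * ℓ) * γ)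
  haveI : Finite α := Subtype.finite
  have e0 : {uy : A × A // IsUnit uy.1 ∧ τ uy.2 = uy.2 ∧ G (Ring.inverse (Nm uy.1) + eA + uy.2 * gA)} ≃ {w : α // G (Z w)} :=
    { toFun := fun w => ⟨⟨w.1, w.2.1, w.2.2.1⟩, w.2.2.2⟩
      invFun := fun w => ⟨w.1.1, w.1.2.1, w.1.2.2, w.2⟩
      left_inv := fun w => rfl
      right_inv := fun w => rfl }
  rw [Nat.card_congr e0]
  have hfixZ : ∀ w : α, τ (Ring.inverse (Nm w.1.1) + eA) = Ring.inverse (Nm w.1.1) + eA := fun w => by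
    rw [map_add, hτe]
    congr 1
    have hu : IsUnit (Nm w.1.1) := w.2.1.mul (w.2.1.map τ)
    rw [← hu.unit_spec, Ring.inverse_unit]
    exact hτinv hu.unit (by rw [hu.unit_spec]; exact hNfix _)
  have hfibre : ∀ z ∈ Set.range Z, Nat.card {w : α // Z w = z} = q ^ (m - 1) * (q + 1) := by
    rintro _ ⟨w₀, rfl⟩
    obtain ⟨⟨u₀, y₀⟩, hu₀, hy₀⟩ := w₀
    have hN₀ : IsUnit (Nm u₀) := hu₀.mul (hu₀.map τ)
    obtain ⟨v, hv⟩ := Ideal.Quotient.mk_surjective u₀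
    have hvu : IsUnit v := isUnit_of_isUnit_mk_pow (R := R) hm (by rw [hv]; exact hu₀)
    have hr : Ideal.Quotient.mk (maximalIdeal R ^ m) (v * σ v) = Nm u₀ := by
      show _ = u₀ * τ u₀; rw [← hv, hτmk, map_mul]
    have hrunit : IsUnit (v * σ v) := hvu.mul (hvu.map σ)
    have hσr : σ (v * σ v) = v * σ v := by rw [map_mul, hσ, mul_comm]
    rw [← natCard_norm_fibre_quotient_pow σ hσ ha hq hm hrunit hσr]
    refine Nat.card_congr
      { toFun := fun w => ⟨w.1.1.1, ?_⟩
        invFun := fun u => ⟨⟨(u.1, y₀), ?_, hy₀⟩, ?_⟩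
        left_inv := fun w => ?_
        right_inv := fun u => rfl }
    · -- `Z w = Z w₀` forces `Nm w.u = Nm u₀`
      have h := w.2
      change Ring.inverse (Nm w.1.1.1) + eA + w.1.1.2 * gA = Ring.inverse (Nm u₀) + eA + y₀ * gA at h
      obtain ⟨hF, -⟩ := fixed_add_mul_frame_inj τ hgAu (hfixZ w.1) (hfixZ ⟨(u₀, y₀), hu₀, hy₀⟩) w.1.2.2 hy₀ h
      have hinv : Ring.inverse (Nm w.1.1.1) = Ring.inverse (Nm u₀) := add_right_cancel hF
      have hNw : IsUnit (Nm w.1.1.1) := w.1.2.1.mul (w.1.2.1.map τ)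
      have key : Nm w.1.1.1 = Nm u₀ := by
        rw [← Ring.inverse_inverse hNw, hinv, Ring.inverse_inverse hN₀]
      show w.1.1.1 * τ w.1.1.1 = Ideal.Quotient.mk _ (v * σ v)
      rw [hr]; exact key
    · -- a norm-fibre element is a unit
      have h : u.1 * τ u.1 = Nm u₀ := u.2.trans hr
      exact isUnit_of_mul_isUnit_left (h ▸ hN₀)
    · show Ring.inverse (u.1 * τ u.1) + eA + y₀ * gA = Ring.inverse (Nm u₀) + eA + y₀ * gA
      have h : u.1 * τ u.1 = Nm u₀ := u.2.trans hr
      rw [h]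
    · apply Subtype.ext; apply Subtype.ext
      have h := w.2
      change Ring.inverse (Nm w.1.1.1) + eA + w.1.1.2 * gA = Ring.inverse (Nm u₀) + eA + y₀ * gA at h
      obtain ⟨-, hY⟩ := fixed_add_mul_frame_inj τ hgAu (hfixZ w.1) (hfixZ ⟨(u₀, y₀), hu₀, hy₀⟩) w.1.2.2 hy₀ h
      exact Prod.ext rfl hY.symm
  rw [Literature.NumberTheory.Automorphic.UnitaryGroup.natCard_subtype_comp_eq_mul Z G _ hfibre]
  congr 1
  have hrange : ∀ z, G z → z ∈ Set.range Z := by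
    intro z hz
    obtain ⟨F, Y, hFfix, hYfix, hzFY⟩ := exists_fixed_add_mul_frame_eq τ hττ hgAu z
    -- the fixed coordinate minus `e` is a unit
    have hGz : ¬ IsUnit ((F + Y * gA) * τ (F + Y * gA) - cA) := by
      rw [← hzFY]
      intro hu
      have hj1 : 1 ≤ j := by omega
      haveI : Nontrivial (R ⧸ maximalIdeal R ^ j) := nontrivial_quotient_pow (R := R) hj1
      have hzero : φ (z * τ z - cA) = 0 := by
        rw [map_sub, hz, hcA, hφ, Ideal.Quotient.factor_mk, sub_self]
      exact not_isUnit_zero (hzero ▸ hu.map φ)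
    have hFe : IsUnit (F - eA) := isUnit_fixed_sub_of_norm_sub_frame_of_isUnit τ hττ hgAu hτe heAu hcnu hFfix hYfix hGz
    set n₁ : A := ↑hFe.unit⁻¹ with hn₁
    have hn₁fix : τ n₁ = n₁ := by
      have h1 : τ (F - eA) = F - eA := by rw [map_sub, hFfix, hτe]
      rw [hn₁]; exact hτinv hFe.unit (by rw [hFe.unit_spec]; exact h1)
    obtain ⟨r₀, hr₀⟩ := Ideal.Quotient.mk_surjective n₁
    have hmem : σ r₀ - r₀ ∈ maximalIdeal R ^ m := by
      rw [← Ideal.Quotient.eq_zero_iff_mem, map_sub, sub_eq_zero, ← hτmk, hr₀, hn₁fix]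
    obtain ⟨r, hrfix, hrr⟩ := exists_fixed_sub_mem σ hσ ha hmem
    have hrn : Ideal.Quotient.mk (maximalIdeal R ^ m) r = n₁ := by
      rw [← hr₀, Ideal.Quotient.eq]; exact hrr
    have hru : IsUnit r := isUnit_of_isUnit_mk_pow (R := R) hm (by rw [hrn, hn₁]; exact Units.isUnit _)
    have hpos : 0 < Nat.card {u : A // u * τ u = Ideal.Quotient.mk _ r} := by
      rw [natCard_norm_fibre_quotient_pow σ hσ ha hq hm hru hrfix]; exact Nat.mul_pos (pow_pos hq0 _) (Nat.succ_pos q)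
    obtain ⟨⟨u, hu⟩⟩ := Nat.card_pos_iff.1 hpos |>.1
    rw [hrn] at hu
    have huunit : IsUnit u := isUnit_of_mul_isUnit_left (by rw [show u * τ u = n₁ from hu, hn₁]; exact Units.isUnit _)
    refine ⟨⟨(u, Y), huunit, hYfix⟩, ?_⟩
    show Ring.inverse (u * τ u) + eA + Y * gA = z
    rw [show u * τ u = n₁ from hu, hn₁, Ring.inverse_unit, inv_inv, hFe.unit_spec, sub_add_cancel, hzFY]
  rw [Nat.card_congr (Equiv.subtypeEquivRight fun z => (and_iff_right_of_imp (hrange z) : z ∈ Set.range Z ∧ G z ↔ G z))]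
  exact natCard_norm_congr_shift σ hσ ha hq hp hσp hj hjm hγ hσγ

include ha hq hg in
/-- **THE PAIR COUNT OF PROP. 13, CASE (e), precision beyond the level, IN THE FRAME CURRENCY, FOR ANY `σ`-FIXED UNIT SHIFT `e`** (`∃`-lift predicate): for `1 ≤ ℓ`,
`2ℓ < j ≤ m + ℓ`, `1 ≤ m`, a `σ`-fixed UNIT `e`, a target `ϖ^{2ℓ}γ` (`γ ∈ (R^σ)^×`; no tie to `e`) and a frame element `g` (`σg − g ∈ Rˣ`),
`#{(u, y) ∈ (R ⧸ 𝔪^m)² : u ∈ (R⧸𝔪^m)^×, σ̄y = y, ∃ w ≡ (uσ̄u)⁻¹ + ē + y·ḡ with ϖ^j ∣ N(w) − ϖ^{2ℓ}γ} = q^{m−1}(q+1) · (q^{(m−ℓ)−(j−2ℓ)} · q^{m−ℓ−1}(q+1))` — the ★ FILE 10 value VERBATIM, over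
★ `natCard_norm_congr_shift_exists`.  ★ p851954 `natCard_pairs_norm_congr_shift_frame_exists` is the special case `e² ≡ 1`. [cite: Flicker1998UnitaryFL, Prop. 13 p. 93] [cite: Serre1979, Ch. V §2 Prop. 3] -/
theorem natCard_pairs_norm_congr_shift_frame_of_isUnit_exists {p : R} (hp : Irreducible p) (hσp : σ p = p) {m j ℓ : ℕ} (hm : 1 ≤ m) (hℓ : 1 ≤ ℓ) (hj : 2 * ℓ < j)
    (hjm : j ≤ m + ℓ) {e γ : R} (he : IsUnit e) (hσe : σ e = e) (hγ : IsUnit γ) (hσγ : σ γ = γ) :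
    Nat.card {uy : (R ⧸ maximalIdeal R ^ m) × (R ⧸ maximalIdeal R ^ m) // IsUnit uy.1 ∧
      Ideal.quotientMap (maximalIdeal R ^ m) σ (maximalIdeal_pow_le_comap σ hσ m) uy.2 = uy.2 ∧
      ∃ w : R, Ideal.Quotient.mk (maximalIdeal R ^ m) w =
          Ring.inverse (uy.1 * Ideal.quotientMap (maximalIdeal R ^ m) σ (maximalIdeal_pow_le_comap σ hσ m) uy.1) +
            Ideal.Quotient.mk (maximalIdeal R ^ m) e + uy.2 * Ideal.Quotient.mk (maximalIdeal R ^ m) g ∧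
        p ^ j ∣ w * σ w - p ^ (2 * ℓ) * γ} =
      (q ^ (m - 1) * (q + 1)) * (q ^ ((m - ℓ) - (j - 2 * ℓ)) * (q ^ ((m - ℓ) - 1) * (q + 1))) := by
  classical
  haveI := CompleteLocalRing.finite_quotient_maximalIdeal_pow (R := R) m
  set A := R ⧸ maximalIdeal R ^ m with hA
  set τ := Ideal.quotientMap (maximalIdeal R ^ m) σ (maximalIdeal_pow_le_comap σ hσ m) with hτ
  have hττ : ∀ z, τ (τ z) = z := quotientMap_quotientMap σ hσ m
  have hτmk : ∀ w : R, τ (Ideal.Quotient.mk _ w) = Ideal.Quotient.mk _ (σ w) := fun w => Ideal.quotientMap_mk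
  haveI : Nontrivial A := nontrivial_quotient_pow (R := R) hm
  haveI : IsLocalRing A := IsLocalRing.of_surjective' (Ideal.Quotient.mk (maximalIdeal R ^ m)) Ideal.Quotient.mk_surjective
  set gA : A := Ideal.Quotient.mk _ g with hgA
  have hgAu : IsUnit (τ gA - gA) := by
    have h := hg.map (Ideal.Quotient.mk (maximalIdeal R ^ m))
    rwa [map_sub, ← hτmk] at h
  have hτinv : ∀ w : Aˣ, τ (w : A) = w → τ (↑w⁻¹ : A) = ↑w⁻¹ := fun w hw => by
    have h1 : τ (↑w⁻¹ : A) * (w : A) = 1 := by rw [← hw, ← map_mul, Units.inv_mul, map_one]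
    calc τ (↑w⁻¹ : A) = τ ↑w⁻¹ * ((w : A) * ↑w⁻¹) := by rw [Units.mul_inv, mul_one]
      _ = ↑w⁻¹ := by rw [← mul_assoc, h1, one_mul]
  have hq0 : 0 < q := by
    rcases Nat.eq_zero_or_pos q with h0 | h0
    · exfalso
      have h1 : 0 < Nat.card (ResidueField R) := Nat.card_pos
      rw [hq, h0] at h1; simp at h1
    · exact h0
  set eA : A := Ideal.Quotient.mk _ e with heA
  have hτe : τ eA = eA := by rw [heA, hτmk, hσe]
  -- the target class `c̄ = ϖ^{2ℓ}γ̄` is a non-unit (`1 ≤ ℓ`); `ē` is a unit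
  set cA : A := Ideal.Quotient.mk _ (p ^ (2 * ℓ) * γ) with hcA
  have hcnu : ¬ IsUnit cA := by
    intro hu
    have hu' : IsUnit (p ^ (2 * ℓ) * γ) := isUnit_of_isUnit_mk_pow (R := R) hm hu
    have hpu : IsUnit (p ^ (2 * ℓ)) := isUnit_of_mul_isUnit_left hu'
    exact hp.not_isUnit ((isUnit_pow_iff (by omega)).1 hpu)
  have hτc : τ cA = cA := by rw [hcA, hτmk, map_mul, map_pow, hσp, hσγ]
  have heAu : IsUnit eA := he.map _
  let Nm : A → A := fun u => u * τ u
  have hNfix : ∀ u, τ (Nm u) = Nm u := fun u => by simp only [Nm, map_mul, hττ, mul_comm]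
  let α := {uy : A × A // IsUnit uy.1 ∧ τ uy.2 = uy.2}
  let Z : α → A := fun w => Ring.inverse (Nm w.1.1) + eA + w.1.2 * gA
  let G : A → Prop := fun z => ∃ w : R, Ideal.Quotient.mk (maximalIdeal R ^ m) w = z ∧ p ^ j ∣ w * σ w - p ^ (2 * ℓ) * γ
  haveI : Finite α := Subtype.finite
  have e0 : {uy : A × A // IsUnit uy.1 ∧ τ uy.2 = uy.2 ∧ G (Ring.inverse (Nm uy.1) + eA + uy.2 * gA)} ≃ {w : α // G (Z w)} :=
    { toFun := fun w => ⟨⟨w.1, w.2.1, w.2.2.1⟩, w.2.2.2⟩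
      invFun := fun w => ⟨w.1.1, w.1.2.1, w.1.2.2, w.2⟩
      left_inv := fun w => rfl
      right_inv := fun w => rfl }
  rw [Nat.card_congr e0]
  have hfixZ : ∀ w : α, τ (Ring.inverse (Nm w.1.1) + eA) = Ring.inverse (Nm w.1.1) + eA := fun w => by
    rw [map_add, hτe]
    congr 1
    have hu : IsUnit (Nm w.1.1) := w.2.1.mul (w.2.1.map τ)
    rw [← hu.unit_spec, Ring.inverse_unit]
    exact hτinv hu.unit (by rw [hu.unit_spec]; exact hNfix _)
  have hfibre : ∀ z ∈ Set.range Z, Nat.card {w : α // Z w = z} = q ^ (m - 1) * (q + 1) := by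
    rintro _ ⟨w₀, rfl⟩
    obtain ⟨⟨u₀, y₀⟩, hu₀, hy₀⟩ := w₀
    have hN₀ : IsUnit (Nm u₀) := hu₀.mul (hu₀.map τ)
    obtain ⟨v, hv⟩ := Ideal.Quotient.mk_surjective u₀
    have hvu : IsUnit v := isUnit_of_isUnit_mk_pow (R := R) hm (by rw [hv]; exact hu₀)
    have hr : Ideal.Quotient.mk (maximalIdeal R ^ m) (v * σ v) = Nm u₀ := by
      show _ = u₀ * τ u₀; rw [← hv, hτmk, map_mul]
    have hrunit : IsUnit (v * σ v) := hvu.mul (hvu.map σ)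
    have hσr : σ (v * σ v) = v * σ v := by rw [map_mul, hσ, mul_comm]
    rw [← natCard_norm_fibre_quotient_pow σ hσ ha hq hm hrunit hσr]
    refine Nat.card_congr
      { toFun := fun w => ⟨w.1.1.1, ?_⟩
        invFun := fun u => ⟨⟨(u.1, y₀), ?_, hy₀⟩, ?_⟩
        left_inv := fun w => ?_
        right_inv := fun u => rfl }
    · have h := w.2
      change Ring.inverse (Nm w.1.1.1) + eA + w.1.1.2 * gA = Ring.inverse (Nm u₀) + eA + y₀ * gA at h
      obtain ⟨hF, -⟩ := fixed_add_mul_frame_inj τ hgAu (hfixZ w.1) (hfixZ ⟨(u₀, y₀), hu₀, hy₀⟩) w.1.2.2 hy₀ h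
      have hinv : Ring.inverse (Nm w.1.1.1) = Ring.inverse (Nm u₀) := add_right_cancel hF
      have hNw : IsUnit (Nm w.1.1.1) := w.1.2.1.mul (w.1.2.1.map τ)
      have key : Nm w.1.1.1 = Nm u₀ := by
        rw [← Ring.inverse_inverse hNw, hinv, Ring.inverse_inverse hN₀]
      show w.1.1.1 * τ w.1.1.1 = Ideal.Quotient.mk _ (v * σ v)
      rw [hr]; exact key
    · have h : u.1 * τ u.1 = Nm u₀ := u.2.trans hr
      exact isUnit_of_mul_isUnit_left (h ▸ hN₀)
    · show Ring.inverse (u.1 * τ u.1) + eA + y₀ * gA = Ring.inverse (Nm u₀) + eA + y₀ * gA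
      have h : u.1 * τ u.1 = Nm u₀ := u.2.trans hr
      rw [h]
    · apply Subtype.ext; apply Subtype.ext
      have h := w.2
      change Ring.inverse (Nm w.1.1.1) + eA + w.1.1.2 * gA = Ring.inverse (Nm u₀) + eA + y₀ * gA at h
      obtain ⟨-, hY⟩ := fixed_add_mul_frame_inj τ hgAu (hfixZ w.1) (hfixZ ⟨(u₀, y₀), hu₀, hy₀⟩) w.1.2.2 hy₀ h
      exact Prod.ext rfl hY.symm
  rw [Literature.NumberTheory.Automorphic.UnitaryGroup.natCard_subtype_comp_eq_mul Z G _ hfibre]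
  congr 1
  have hrange : ∀ z, G z → z ∈ Set.range Z := by
    intro z hz
    obtain ⟨F, Y, hFfix, hYfix, hzFY⟩ := exists_fixed_add_mul_frame_eq τ hττ hgAu z
    have hGz : ¬ IsUnit ((F + Y * gA) * τ (F + Y * gA) - cA) := by
      rw [← hzFY]
      obtain ⟨w, hwz, hdw⟩ := hz
      have hcl : z * τ z - cA = Ideal.Quotient.mk (maximalIdeal R ^ m) (w * σ w - p ^ (2 * ℓ) * γ) := by
        rw [← hwz, hτmk, hcA, ← map_mul, ← map_sub]
      have hmem : w * σ w - p ^ (2 * ℓ) * γ ∈ maximalIdeal R := by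
        rw [Irreducible.maximalIdeal_eq hp, Ideal.mem_span_singleton]
        exact dvd_trans (dvd_pow_self p (by omega)) hdw
      rw [hcl]
      intro hu
      obtain ⟨v, hv⟩ := Ideal.Quotient.mk_surjective (↑hu.unit⁻¹ : A)
      have h1 : Ideal.Quotient.mk (maximalIdeal R ^ m) ((w * σ w - p ^ (2 * ℓ) * γ) * v) = 1 := by
        rw [map_mul, hv]; exact hu.mul_val_inv
      rw [← map_one (Ideal.Quotient.mk (maximalIdeal R ^ m)), Ideal.Quotient.eq] at h1
      have h1' : (w * σ w - p ^ (2 * ℓ) * γ) * v - 1 ∈ maximalIdeal R := Ideal.pow_le_self (by omega) h1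
      have : (1 : R) ∈ maximalIdeal R := by
        have := Ideal.sub_mem _ (Ideal.mul_mem_right v _ hmem) h1'
        rwa [sub_sub_cancel] at this
      exact (Ideal.ne_top_iff_one _).1 (Ideal.IsMaximal.ne_top (IsLocalRing.maximalIdeal.isMaximal R)) this
    have hFe : IsUnit (F - eA) := isUnit_fixed_sub_of_norm_sub_frame_of_isUnit τ hττ hgAu hτe heAu hcnu hFfix hYfix hGz
    set n₁ : A := ↑hFe.unit⁻¹ with hn₁
    have hn₁fix : τ n₁ = n₁ := by
      have h1 : τ (F - eA) = F - eA := by rw [map_sub, hFfix, hτe]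
      rw [hn₁]; exact hτinv hFe.unit (by rw [hFe.unit_spec]; exact h1)
    obtain ⟨r₀, hr₀⟩ := Ideal.Quotient.mk_surjective n₁
    have hmem : σ r₀ - r₀ ∈ maximalIdeal R ^ m := by
      rw [← Ideal.Quotient.eq_zero_iff_mem, map_sub, sub_eq_zero, ← hτmk, hr₀, hn₁fix]
    obtain ⟨r, hrfix, hrr⟩ := exists_fixed_sub_mem σ hσ ha hmem
    have hrn : Ideal.Quotient.mk (maximalIdeal R ^ m) r = n₁ := by
      rw [← hr₀, Ideal.Quotient.eq]; exact hrr
    have hru : IsUnit r := isUnit_of_isUnit_mk_pow (R := R) hm (by rw [hrn, hn₁]; exact Units.isUnit _)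
    have hpos : 0 < Nat.card {u : A // u * τ u = Ideal.Quotient.mk _ r} := by
      rw [natCard_norm_fibre_quotient_pow σ hσ ha hq hm hru hrfix]; exact Nat.mul_pos (pow_pos hq0 _) (Nat.succ_pos q)
    obtain ⟨⟨u, hu⟩⟩ := Nat.card_pos_iff.1 hpos |>.1
    rw [hrn] at hu
    have huunit : IsUnit u := isUnit_of_mul_isUnit_left (by rw [show u * τ u = n₁ from hu, hn₁]; exact Units.isUnit _)
    refine ⟨⟨(u, Y), huunit, hYfix⟩, ?_⟩
    show Ring.inverse (u * τ u) + eA + Y * gA = z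
    rw [show u * τ u = n₁ from hu, hn₁, Ring.inverse_unit, inv_inv, hFe.unit_spec, sub_add_cancel, hzFY]
  rw [Nat.card_congr (Equiv.subtypeEquivRight fun z => (and_iff_right_of_imp (hrange z) : z ∈ Set.range Z ∧ G z ↔ G z))]
  exact natCard_norm_congr_shift_exists σ hσ ha hq hp hσp hj hjm hγ hσγ

end Count

end Literature.NumberTheory.LocalFields.UnramifiedQuadraticNorm
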